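import Mathlib
import Summits.AtomisticToContinuum.Crystallization.Theses.PhononSlackCertificates

/-!
# Route `PhononSlackCertificates`, crux `NearFieldConvexity` (stmt-AtomisticToContinuum-13958), line `Sketch`:
stub `stub_tractionHalfStress`

Traction = half the stress for a centrally symmetric weighted bond star (card zero-stress-whitney-blocks).
-/

noncomputable section

open scoped BigOperators InnerProductSpace Matrix ComplexOrder
open Literature.MathematicalPhysics.StatisticalMechanics Literature.Geometry.DiscreteGeometry

namespace Summit.AtomisticToContinuum.Crystallization.Theorems.PhononSlackNearFieldConvexity

local notation "E3" => EuclideanSpace ℝ (Fin 3)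

/-- **Stub (card A): traction = half the stress** for a centrally symmetric weighted bond star
(`σ` an involution-like relabelling with `ζ (σ l) = −ζ l`, `c (σ l) = c l`): the sum over bonds crossing
a plane with normal `n` upward equals half the stress applied to `n`. -/
theorem stub_tractionHalfStress {ι : Type*} [Fintype ι] (c : ι → ℝ) (ζ : ι → E3) (σ : ι ≃ ι)
    (hζ : ∀ l, ζ (σ l) = -ζ l) (hc : ∀ l, c (σ l) = c l) (n : E3) :
    ∑ l, (max ⟪ζ l, n⟫_ℝ 0 * c l) • ζ l = (1 / 2 : ℝ) • ∑ l, (c l * ⟪ζ l, n⟫_ℝ) • ζ l := by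
  -- reindex the traction sum by the central symmetry `σ`
  have hre : ∑ l, (max (-⟪ζ l, n⟫_ℝ) 0 * c l) • (-ζ l) = ∑ l, (max ⟪ζ l, n⟫_ℝ 0 * c l) • ζ l :=
    Fintype.sum_equiv σ _ _ fun l => by rw [hζ, hc, inner_neg_left]
  -- twice the traction is the stress applied to `n`
  have key : (2 : ℝ) • ∑ l, (max ⟪ζ l, n⟫_ℝ 0 * c l) • ζ l = ∑ l, (c l * ⟪ζ l, n⟫_ℝ) • ζ l := by
    calc (2 : ℝ) • ∑ l, (max ⟪ζ l, n⟫_ℝ 0 * c l) • ζ l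
        = ∑ l, (max ⟪ζ l, n⟫_ℝ 0 * c l) • ζ l + ∑ l, (max (-⟪ζ l, n⟫_ℝ) 0 * c l) • (-ζ l) := by
          rw [two_smul, hre]
      _ = ∑ l, (c l * ⟪ζ l, n⟫_ℝ) • ζ l := by
          rw [← Finset.sum_add_distrib]
          refine Finset.sum_congr rfl fun l _ => ?_
          rw [smul_neg, ← sub_eq_add_neg, ← sub_smul, ← sub_mul, max_zero_sub_max_neg_zero_eq_self,
            mul_comm]
  rw [← key, smul_smul, show (1 / 2 : ℝ) * 2 = 1 by norm_num, one_smul]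

end Summit.AtomisticToContinuum.Crystallization.Theorems.PhononSlackNearFieldConvexity
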